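import Summits.BirchSwinnertonDyer.BirchSwinnertonDyer.Theorems.AdditiveBranchIMCGordTwoRankZeroOffCaseOneFieldSupplyR0Class
import Summits.BirchSwinnertonDyer.Rank1Residual.X11b.CastellaErratumTwist
import Literature.NumberTheory.EllipticCurves.QuadraticTwistPadicReduction
import Literature.NumberTheory.EllipticCurves.BSDSelmerSkinnerThmBProofs
import Literature.NumberTheory.EllipticCurves.LFunctionPrimeCoeff
import HarnessLib

/-!
# Route `AdditiveBranchIMC` (rung K1), cruxes 19357 / 19359, supply stubs: FIELD 2, part 3 —
# local analysis of the partner `A ≅ E^{(u)}` (non-split at the Wan prime, the Ram witness,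
# `p ∤ ∏ c_ℓ(A)`) and the assembled FIELD 2 of `stub_fieldSupplyR0`

Cell `bsd-addord`, seat `bsd-line-addord-w2`. THEOREMS ONLY. From part 2 (`exists_ramifiedClass_partner`):
`A ≅ E^{(u)}` with `u = p* T d ≡ 1 (mod 4)` square-free and `(u/ℓ) = 1` (resp. `u ≡ 1 (mod 8)`) at every
bad prime `ℓ ≠ p` of `E`. Hence `u ∈ (ℚ_ℓ^×)²` there (split prime of `ℚ(√u)`,
`isSquare_padic_discr_of_splitsIn`), so at those primes `A` and `E` are `ℚ_ℓ`-isomorphic: same reduction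
type (`X11b.mult_iff_of_twist`, `hasSplitMultiplicativeReductionAtPrime_quadraticTwist_iff`), same
`v_ℓ(Δ_min)` (`X11b.padicValInt_minimalDiscriminantInt_twist_eq`), same `c_ℓ`
(`localTamagawaNumber_eq_of_twist_of_isSquare`); at every other place `A` is not split multiplicative
(`j(A) = j(E)` is integral at the good primes of `E`; `A` is good at `p`), so `c_v(A) ≤ 4 < p`
(Kodaira–Néron, `Castella2018.TamagawaQuadratic.kodairaNeron_localTamagawaNumber`). Assembled:
`exists_fieldTwo_gordTwo` = the `(K'', A)` half of `stub_fieldSupplyR0` with `RamifiedKolyvaginField`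
spelled out, from `friedbergHoffstein_exists_heegnerField_splitDivisors_twist_ne_zero` + modularity.

References: [SilvermanAEC2009] VII.5.1, VII.6.1, X.5.4; [FriedbergHoffstein1995] Thm. B;
[JetchevSkinnerWan2017] §7.4.1.
-/

set_option linter.dupNamespace false

noncomputable section

open scoped Classical

open WeierstrassCurve NumberField IsDedekindDomain Rat.HeightOneSpectrum
  Literature.NumberTheory.EllipticCurves
  Literature.NumberTheory.EllipticCurves.ModularForms
  Literature.NumberTheory.EllipticCurves.Rank1Residual
  Literature.NumberTheory.QuadraticFields
  Summit.BirchSwinnertonDyer.Rank1Residual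
  Summit.BirchSwinnertonDyer.Rank1Residual.Additive

namespace Summit.BirchSwinnertonDyer.BirchSwinnertonDyer.Theorems.ThreeFieldRoadSupply

open NumberTheorySymbols Literature.NumberTheory.EllipticCurves.Castella2018.TamagawaQuadratic

/-! ### §1 Squares in `ℚ_ℓ` from the Kronecker symbol of a fundamental discriminant -/

/-- A fundamental discriminant `u ≡ 1 (mod 4)` with `(u/ℓ) = 1` (`ℓ` odd) resp. `u ≡ 1 (mod 8)` (`ℓ = 2`)
is a square in `ℚ_ℓ` (the prime `ℓ` splits in `ℚ(√u)`). [folklore] -/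
theorem isSquare_padic_of_fundamental {u : ℤ} (hu4 : u % 4 = 1) (husq : Squarefree u) (hu1 : u ≠ 1)
    {ℓ : ℕ} [hℓ : Fact ℓ.Prime] (h : (ℓ = 2 → u % 8 = 1) ∧ (ℓ ≠ 2 → J(u | ℓ) = 1)) :
    IsSquare (((u : ℤ) : ℚ) : ℚ_[ℓ]) := by
  obtain ⟨Ku, _, _, h2, hdisc⟩ := Quadratic.exists_numberField_discr_eq (D := u) (Or.inl ⟨hu4, husq, hu1⟩)
  have hs : ((Ideal.span {(ℓ : ℤ)}).primesOver (𝓞 Ku)).ncard = 2 := by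
    by_cases hℓ2 : ℓ = 2
    · subst hℓ2
      exact (Quadratic.ncard_primesOver_two_eq_two_iff h2).mpr (by rw [hdisc]; exact h.1 rfl)
    · exact (Quadratic.ncard_primesOver_eq_two_iff_jacobiSym h2 hℓ.out hℓ2).mpr
        (by rw [hdisc]; exact h.2 hℓ2)
  have := isSquare_padic_discr_of_splitsIn h2 hs
  rwa [hdisc] at this

/-! ### §2 `p ∤ ∏ c_v` from a place-by-place criterion -/

/-- If no local Tamagawa number of `A/ℚ` is divisible by `p`, then `p ∤ ∏_v c_v(A)` (the product is a
finite product over the bad places). [cite: SilvermanAEC2009, Thm VII.6.1] -/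
theorem not_dvd_tamagawaProduct_of_forall (A : WeierstrassCurve ℚ) [A.IsElliptic] (p : ℕ)
    [hp : Fact p.Prime]
    (h : ∀ v : HeightOneSpectrum (𝓞 ℚ),
      ¬ p ∣ (A.baseChange (v.adicCompletion ℚ)).localTamagawaNumber (v.adicCompletionIntegers ℚ)) :
    ¬ p ∣ A.tamagawaProduct := by
  set c : HeightOneSpectrum (𝓞 ℚ) → ℕ := fun v =>
    (A.baseChange (v.adicCompletion ℚ)).localTamagawaNumber (v.adicCompletionIntegers ℚ) with hc
  have hfin : (Function.mulSupport c).Finite := A.mulSupport_localTamagawaNumber_finite_holds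
  rw [show A.tamagawaProduct = ∏ᶠ v, c v from rfl,
    finprod_eq_prod_of_mulSupport_subset c (s := hfin.toFinset) (by simp)]
  intro hdvd
  obtain ⟨v, -, hv⟩ := (Prime.dvd_finsetProd_iff hp.out.prime _).mp hdvd
  exact h v hv

/-! ### §3 FIELD 2 assembled on the (G-ord, `e = 2`) cell -/

section FieldTwo

variable (W : WeierstrassCurve ℚ) [W.IsElliptic] [W.IsGloballyMinimal] (p : ℕ) [hp : Fact p.Prime]
  {q : ℕ} [hq : Fact q.Prime] (K : Type) [Field K] [NumberField K]
  {Wd : WeierstrassCurve ℚ} [Wd.IsElliptic] [Wd.IsGloballyMinimal]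

omit [Wd.IsGloballyMinimal] in
/-- **FIELD 2 of `stub_fieldSupplyR0` (line `three_field_road` v3, crux 19357), from Friedberg–Hoffstein
Thm. B with prescribed splitting.** For `(E, p)` on the (G-ord, `e = 2`) cell with `p ≥ 5`, `w(E) = +1`,
`ρ̄_{E,p}` onto, `p ∤ ∏ c(E)`, a Wan prime `q` (`q ∉ {2, p}`, non-split multiplicative, `p ∤ v_q(Δ)`), the
tame-road field `K` and a globally minimal `Wd ≅ E^{(d_K)}`: a `p`-RAMIFIED Kolyvagin field `K''` for
`(Wd, A)` (`RamifiedKolyvaginField Wd A p K''` spelled out) with a free ramified prime, and a globally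
minimal `A ≅ Wd^{(d_{K''})}` of analytic rank `0`, good ordinary at `p`, `ρ̄_{A,p}` onto, multiplicative at `q`
with `p ∤ v_q(Δ_A)`, and `p ∤ ∏ c(A)`. [cite: FriedbergHoffstein1995, Thm. B (1), as applied in JetchevSkinnerWan2017 §7.4.1]
[cite: SilvermanAEC2009, X.5 Cor. 5.4, VII.5.1 and Thm VII.6.1] -/
theorem exists_fieldTwo_gordTwo
    (hFH : friedbergHoffstein_exists_heegnerField_splitDivisors_twist_ne_zero)
    (hmod : exists_isNewformOf) (hL : hasEntireLFunction_rat)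
    (hp5 : 5 ≤ p) (hw : W.rootNumber = 1) (hcell : N10.CellGordTwo W p) (hsurj : Surj W p)
    (htam : ¬ p ∣ W.tamagawaProduct)
    (hqp : q ≠ p) (hq2 : q ≠ 2) (hqm : W.HasMultiplicativeReductionAtPrime q)
    (hqns : ¬ W.HasSplitMultiplicativeReductionAtPrime q)
    (hqv : ¬ p ∣ padicValInt q W.minimalDiscriminantInt)
    (hK : IsImaginaryQuadratic K) (h2K : ((Ideal.span {(2 : ℤ)}).primesOver (𝓞 K)).ncard = 2)
    (hqd : (q : ℤ) ∣ NumberField.discr K)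
    (hsplit : ∀ ℓ : ℕ, ℓ.Prime → ℓ ∣ W.conductorNorm ℤ → ℓ ≠ q →
      ((Ideal.span {(ℓ : ℤ)}).primesOver (𝓞 K)).ncard = 2)
    (Cd : VariableChange ℚ) (hWd : Cd • W.quadraticTwist (NumberField.discr K : ℚ) = Wd) :
    ∃ (K'' : Type) (_ : Field K'') (_ : NumberField K'')
      (A : WeierstrassCurve ℚ) (_ : A.IsElliptic) (_ : A.IsGloballyMinimal),
      (IsImaginaryQuadratic K'' ∧ (p : ℤ) ∣ NumberField.discr K'' ∧
        (∀ ℓ : ℕ, ℓ.Prime → ℓ ∣ Wd.conductorNorm ℤ → ¬ (ℓ : ℤ) ∣ NumberField.discr K'' →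
          SatisfiesHeegnerHypothesis ℓ K'') ∧
        (∀ ℓ : ℕ, (hℓ : ℓ.Prime) → ℓ ∣ Wd.conductorNorm ℤ → (ℓ : ℤ) ∣ NumberField.discr K'' → ℓ ≠ p →
          (haveI : Fact ℓ.Prime := ⟨hℓ⟩;
            A.HasMultiplicativeReductionAtPrime ℓ ∧ ¬ A.HasSplitMultiplicativeReductionAtPrime ℓ))) ∧
      (∃ ℓ : ℕ, ℓ.Prime ∧ (ℓ : ℤ) ∣ NumberField.discr K'' ∧ ℓ ≠ p ∧ ¬ ℓ ∣ Wd.conductorNorm ℤ) ∧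
      (∃ C : VariableChange ℚ, C • Wd.quadraticTwist (NumberField.discr K'' : ℚ) = A) ∧
      A.analyticRank = 0 ∧ GoodOrd A p ∧ Surj A p ∧
      (∃ ℓ : ℕ, ∃ _ : Fact ℓ.Prime, ℓ ≠ p ∧ A.HasMultiplicativeReductionAtPrime ℓ ∧
        ¬ p ∣ padicValInt ℓ A.minimalDiscriminantInt) ∧
      ¬ p ∣ A.tamagawaProduct := by
  have hp2 : p ≠ 2 := by omega
  obtain ⟨ℓ₀, T, d, K'', iF'', iN'', A, iA, iAm, hℓ₀, hℓ₀p, hℓ₀q, hℓ₀NWd, hdisc, hK'', hsplit'', hram'',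
      hAWd, ⟨Cu, hCu⟩, hu4, husq, hJu, hrA, hgoA, hsurjA⟩ :=
    exists_ramifiedClass_partner W p K hFH hmod hL hp5 hw hcell hsurj hqp hq2 hK h2K hqd hsplit Cd hWd
  set u : ℤ := ((-1 : ℤ) ^ (p / 2) * p) * T * d with hu
  -- `u ≠ 0, 1`, `p ∣ u`
  have hpu : (p : ℤ) ∣ u := by
    rw [hu]
    refine Dvd.dvd.mul_right (Dvd.dvd.mul_right ?_ _) _
    exact Dvd.intro_left _ rfl
  have hu1 : u ≠ 1 := fun h ↦ by
    rw [h] at hpu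
    exact hp.out.ne_one (by exact_mod_cast Int.eq_one_of_dvd_one (by norm_num) hpu)
  have hu0 : u ≠ 0 := fun h ↦ by rw [h] at hu4; norm_num at hu4
  have huq : ((u : ℤ) : ℚ) ≠ 0 := by exact_mod_cast hu0
  -- squares at the bad primes `≠ p` of `E`
  have hsq : ∀ ℓ : ℕ, (hℓ : ℓ.Prime) → ℓ ∣ W.conductorNorm ℤ → ℓ ≠ p →
      (haveI : Fact ℓ.Prime := ⟨hℓ⟩; IsSquare (((u : ℤ) : ℚ) : ℚ_[ℓ])) := by
    intro ℓ hℓ hℓN hℓp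
    haveI : Fact ℓ.Prime := ⟨hℓ⟩
    exact isSquare_padic_of_fundamental hu4 husq hu1 (hJu ℓ hℓ hℓN hℓp)
  -- at the Wan prime `q`
  have hqN : q ∣ W.conductorNorm ℤ :=
    (W.dvd_conductorNorm_iff_not_hasGoodReductionAtPrime q).mpr
      (not_hasGoodReductionAtPrime_of_hasMultiplicativeReductionAtPrime q hqm)
  have hsqq : IsSquare (((u : ℤ) : ℚ) : ℚ_[q]) := hsq q hq.out hqN hqp
  have hmultA : A.HasMultiplicativeReductionAtPrime q :=
    (X11b.mult_iff_of_twist W huq hsqq A hCu).mpr hqm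
  have hnsA : ¬ A.HasSplitMultiplicativeReductionAtPrime q := by
    haveI := W.isElliptic_quadraticTwist huq
    rw [← hCu, hasSplitMultiplicativeReductionAtPrime_smul_iff,
      hasSplitMultiplicativeReductionAtPrime_quadraticTwist_iff W huq (by simpa using hsqq)]
    exact hqns
  have hΔq : padicValInt q A.minimalDiscriminantInt = padicValInt q W.minimalDiscriminantInt :=
    X11b.padicValInt_minimalDiscriminantInt_twist_eq W q huq (by simpa using hsqq) Cu hCu
  -- the Tamagawa product of `A`
  have hjA : A.j = W.j := AdditivePotMult.j_of_model_twist huq ⟨Cu, hCu⟩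
  have htamA : ¬ p ∣ A.tamagawaProduct := by
    refine not_dvd_tamagawaProduct_of_forall A p fun v ↦ ?_
    set ℓ : ℕ := (primesEquiv v : ℕ) with hℓdef
    haveI hℓF : Fact ℓ.Prime := ⟨(primesEquiv v).2⟩
    by_cases hcase : ℓ ∣ W.conductorNorm ℤ ∧ ℓ ≠ p
    · -- `A ⊗ ℚ_ℓ ≅ E ⊗ ℚ_ℓ`: same local Tamagawa number, and `p ∤ c_ℓ(E)`
      rw [localTamagawaNumber_eq_of_twist_of_isSquare W v (ℓ := ℓ) rfl huq
        (hsq ℓ hℓF.out hcase.1 hcase.2) A hCu]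
      intro hdvd
      apply htam
      set cW : HeightOneSpectrum (𝓞 ℚ) → ℕ := fun v =>
        (W.baseChange (v.adicCompletion ℚ)).localTamagawaNumber (v.adicCompletionIntegers ℚ) with hcW
      have hfin : (Function.mulSupport cW).Finite := W.mulSupport_localTamagawaNumber_finite_holds
      rw [show W.tamagawaProduct = ∏ᶠ v, cW v from rfl,
        finprod_eq_prod_of_mulSupport_subset cW (s := hfin.toFinset) (by simp)]
      by_cases hv1 : cW v = 1
      · exfalso
        have : p ∣ 1 := by rw [← hv1]; exact hdvd
        exact hp.out.ne_one (Nat.dvd_one.mp this)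
      · exact hdvd.trans (Finset.dvd_prod_of_mem cW (hfin.mem_toFinset.mpr hv1))
    · -- `A` is not split multiplicative at `v`: `c_v(A) ≤ 4 < p`
      obtain ⟨h1, -, h4⟩ := kodairaNeron_localTamagawaNumber A v
      have hns : ¬ A.HasSplitMultiplicativeReductionAt v := by
        intro hsplitv
        have hmult := hsplitv.hasMultiplicativeReductionAt
        have hlt := one_lt_valuation_j v A hmult
        have hle : v.valuation ℚ A.j ≤ 1 := by
          by_cases hℓp : ℓ = p
          · -- `A` is good at `p`
            refine Additive.valuation_j_le_one_of_hasGoodReductionAt A v ?_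
            refine (hasGoodReductionAtPrime_iff_hasGoodReductionAt_ringOfIntegers v A).mp ?_
            have hg : A.HasGoodReductionAtPrime p := hgoA.1
            have key : ∀ (n : ℕ) (i₁ : Fact n.Prime) (i₂ : Fact p.Prime), n = p →
                @HasGoodReductionAtPrime A p i₂ → @HasGoodReductionAtPrime A n i₁ := by
              rintro n i₁ i₂ rfl h; exact h
            exact key _ _ _ hℓp hg
          · -- `E` is good at `ℓ ∤ N_E`, and `j(A) = j(E)`
            have hℓN : ¬ ℓ ∣ W.conductorNorm ℤ := fun h ↦ hcase ⟨h, hℓp⟩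
            have hgood : W.HasGoodReductionAtPrime ℓ :=
              not_not.mp (mt (W.dvd_conductorNorm_iff_not_hasGoodReductionAtPrime ℓ).mpr hℓN)
            rw [hjA]
            exact Additive.valuation_j_le_one_of_hasGoodReductionAt W v
              ((hasGoodReductionAtPrime_iff_hasGoodReductionAt_ringOfIntegers v W).mp hgood)
        exact (not_lt.mpr hle) hlt
      have hc4 := h4 hns
      intro hdvd
      have := Nat.le_of_dvd (by omega) hdvd
      omega
  refine ⟨K'', iF'', iN'', A, iA, iAm, ⟨hK'', ?_, ?_, ?_⟩, ⟨ℓ₀, hℓ₀, ?_, hℓ₀p, hℓ₀NWd⟩, hAWd, hrA,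
    hgoA, hsurjA, ⟨q, hq, hqp, hmultA, by rw [hΔq]; exact hqv⟩, htamA⟩
  · -- `p ∣ d_{K''}`
    rw [hdisc]
    exact Dvd.dvd.mul_right (Dvd.dvd.mul_right (Dvd.dvd.mul_right (Dvd.intro_left _ rfl) _) _) _
  · -- every prime of `N_{Wd}` off `d_{K''}` splits in `K''`
    intro ℓ hℓ hℓN hℓD
    have hℓp : ℓ ≠ p := by
      rintro rfl
      apply hℓD
      rw [hdisc]
      exact Dvd.dvd.mul_right (Dvd.dvd.mul_right (Dvd.dvd.mul_right (Dvd.intro_left _ rfl) _) _) _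
    have hℓq : ℓ ≠ q := by
      rintro rfl
      apply hℓD
      rw [hdisc]
      exact Dvd.dvd.mul_right (Dvd.dvd.mul_right (Dvd.dvd.mul_left (Dvd.intro_left _ rfl) _) _) _
    exact hsplit'' ℓ hℓ (hℓN.mul_left _) hℓp hℓq
  · -- the common primes of `N_{Wd}` and `d_{K''}` other than `p`: only `q`, where `A` is non-split
    intro ℓ hℓ hℓN hℓD hℓp
    rcases hram'' ℓ hℓ hℓD (hℓN.mul_left _) with h | h
    · exact (hℓp h).elim
    · subst h
      exact ⟨hmultA, hnsA⟩
  · -- the free prime `ℓ₀ ∣ d_{K''}`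
    rw [hdisc]
    exact Dvd.dvd.mul_right (Dvd.dvd.mul_left (Dvd.intro_left _ rfl) _) _

end FieldTwo

end Summit.BirchSwinnertonDyer.BirchSwinnertonDyer.Theorems.ThreeFieldRoadSupply

end
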